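import Summits.Ventures.PercRepro.C026LemmaD

/-!
# mine-3's Theorem M: the direct-access part of (2×) (p5, gen 15)

mine-3 (`proofs/MINE3-FLIPS.md` §5, INBOX 5160): for a mark `m ∈ {a, b}` and a configuration `S` whose
closed `c`-cluster `D = Com_c(S̄)` misses `m`, the **sealed flip** `M_m(S) = S Δ (E_inc(D) ∖ E(D, m))`
flips every edge at `D` except the edges between `D` and `m`, which keep their state.

* `sealFlip c m ω` — `M_m(S)`; `ConnAvoid ω X u v` — an open path of `ω` from `u` to `v` with every
  vertex outside `X`; `OpenEdgeInto ω c m` — `m` has an open edge into `D`; `NTwo ω a b c` — mine-3's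
  `N² = {S : a ~_S b, c ≁_{S̄} a, c ≁_{S̄} b, every open a–b path meets D}`;
* **the LEMMA**: `cluster_closeAt_sealFlip` (`D = Com_c(M_m(S) − m)`: `D` is the open cluster of `c` in
  the image with the vertex `m` deleted, hence `sealFlip_injOn`: `M_m` is injective on `{S : m ∉ D}`)
  and `cluster_sealFlip_eq` (`Com_c(M_m(S)) = D ∪ A_m`, `A_m` = the open component of `m` in `G − D`,
  when `m` has an open edge into `D`);
* **THEOREM M**: `card_nTwo_a_le` (`#N²_a ≤ #ac|b`), `card_nTwo_b_le` (`#N²_b ≤ #bc|a`) and their sum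
  `card_nTwo_a_add_nTwo_b_le`; the general form `card_directSource_le` does not use `a ~_S b`, and
  `card_sep_openEdgeInto_le` is **THEOREM M′** (the direct-access part of Lemma T on the deletion side:
  sources with `a ≁_S b`; mine-3's `DB_a` is a subset).
-/

namespace PercRepro

open Finset

namespace MultiGraph

section DirectAccess

variable {V E : Type*} (G : MultiGraph V E)

/-- `ConnAvoid ω X u v`: `u` and `v` are joined by a path of open edges of `ω` all of whose vertices
(the endpoints included) lie outside `X`. -/
def ConnAvoid (ω : Config E) (X : Set V) (u v : V) : Prop :=
  Relation.ReflTransGen (fun x y => G.OpenAdj ω x y ∧ x ∉ X ∧ y ∉ X) u v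

/-- mine-3's `N²`: `a ~_S b`, the closed cluster `D = Com_c(S̄)` misses `a` and `b`, and every open
`a`–`b` path of `S` meets `D`. -/
def NTwo (ω : Config E) (a b c : V) : Prop :=
  G.Conn ω a b ∧ ¬ G.Conn ωᶜ c a ∧ ¬ G.Conn ωᶜ c b ∧ ¬ G.ConnAvoid ω (G.cluster ωᶜ c) a b

/-- `m` has an open edge into the closed cluster `D = Com_c(S̄)` (direct access). -/
def OpenEdgeInto (ω : Config E) (c m : V) : Prop :=
  ∃ e, ω e = true ∧ e ∈ G.edgesAt (G.cluster ωᶜ c) ∧ e ∈ G.edgesAt ({m} : Set V)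

/-- The direct-access sources of the mark `m` against the mark `m'`: `D = Com_c(S̄)` misses `m` and
`m'`, no open path of `S` avoiding `D` joins `m` to `m'`, and `m` has an open edge into `D`
(`N²_m` without the condition `a ~_S b`, which the proof of Theorem M never uses). -/
def DirectSource (ω : Config E) (c m m' : V) : Prop :=
  ¬ G.Conn ωᶜ c m ∧ ¬ G.Conn ωᶜ c m' ∧ ¬ G.ConnAvoid ω (G.cluster ωᶜ c) m m' ∧ G.OpenEdgeInto ω c m

open Classical in
/-- **mine-3's sealed flip** `M_m(S) = S Δ (E_inc(D) ∖ E(D, m))`, `D = Com_c(S̄)`: every edge at the closed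
cluster of `c` is flipped, except the edges at `m`, which keep their state. -/
noncomputable def sealFlip (c m : V) (ω : Config E) : Config E :=
  fun e => if e ∈ G.edgesAt (G.cluster ωᶜ c) ∧ e ∉ G.edgesAt ({m} : Set V) then !ω e else ω e

variable {G}

/-! ### Paths avoiding a vertex set -/

/-- `ConnAvoid` is symmetric. -/
theorem ConnAvoid.symm {ω : Config E} {X : Set V} {u v : V} (h : G.ConnAvoid ω X u v) :
    G.ConnAvoid ω X v u := by
  unfold ConnAvoid at h ⊢
  induction h with
  | refl => exact Relation.ReflTransGen.refl
  | tail _ hbc ih =>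
    exact (Relation.ReflTransGen.single ⟨hbc.1.symm, hbc.2.2, hbc.2.1⟩).trans ih

/-- An avoiding path is an open path. -/
theorem ConnAvoid.conn {ω : Config E} {X : Set V} {u v : V} (h : G.ConnAvoid ω X u v) :
    G.Conn ω u v := by
  unfold ConnAvoid at h
  unfold Conn
  induction h with
  | refl => exact Relation.ReflTransGen.refl
  | tail _ hxy ih => exact ih.tail hxy.1

/-- The far endpoint of an avoiding path from a vertex outside `X` is outside `X`. -/
theorem ConnAvoid.notMem_of_notMem {ω : Config E} {X : Set V} {u v : V}
    (h : G.ConnAvoid ω X u v) (hu : u ∉ X) : v ∉ X := by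
  unfold ConnAvoid at h
  induction h with
  | refl => exact hu
  | tail _ hbc _ => exact hbc.2.2

/-! ### The sealed flip edge by edge -/

/-- The sealed flip flips an edge at `D` that is not at `m`. -/
theorem sealFlip_apply_of_mem {c m : V} {ω : Config E} {e : E}
    (he : e ∈ G.edgesAt (G.cluster ωᶜ c)) (hm : e ∉ G.edgesAt ({m} : Set V)) :
    G.sealFlip c m ω e = !ω e := by
  simp [sealFlip, he, hm]

/-- The sealed flip keeps every edge at `m`. -/
theorem sealFlip_apply_of_mem_m {c m : V} {ω : Config E} {e : E}
    (hm : e ∈ G.edgesAt ({m} : Set V)) : G.sealFlip c m ω e = ω e := by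
  simp [sealFlip, hm]

/-- The sealed flip keeps every edge away from `D`. -/
theorem sealFlip_apply_of_notMem {c m : V} {ω : Config E} {e : E}
    (he : e ∉ G.edgesAt (G.cluster ωᶜ c)) : G.sealFlip c m ω e = ω e := by
  simp [sealFlip, he]

/-- (F1 at `m`): when `m ∉ D`, an edge at `D` and at `m` is a boundary edge of the closed cluster
`D`, hence closed in `S̄` (open in `S`). -/
theorem compl_eq_false_of_mem_edgesAt_of_mem_edgesAt_m {c m : V} {ω : Config E}
    (hm : ¬ G.Conn ωᶜ c m) {e : E} (he : e ∈ G.edgesAt (G.cluster ωᶜ c))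
    (hem : e ∈ G.edgesAt ({m} : Set V)) : ωᶜ e = false := by
  by_contra h
  have h' : ωᶜ e = true := by simpa using h
  have hfst : G.fst e ∈ G.cluster ωᶜ c := by
    rcases he with he | he
    · exact he
    · exact G.fst_mem_cluster_of_open h' he
  have hsnd : G.snd e ∈ G.cluster ωᶜ c := by
    rcases he with he | he
    · exact G.snd_mem_cluster_of_open h' he
    · exact he
  rcases hem with hem | hem
  · rw [Set.mem_singleton_iff] at hem
    exact hm (by rw [← hem]; exact hfst)
  · rw [Set.mem_singleton_iff] at hem
    exact hm (by rw [← hem]; exact hsnd)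

/-! ### The LEMMA: decoding, injectivity, and the cluster of `c` in the image -/

/-- **mine-3's LEMMA (decoding)**: `D = Com_c(M_m(S) − m)` — the closed cluster of `c` is the open
cluster of `c` in the sealed flip with every edge at `m` closed (the vertex `m` deleted). -/
theorem cluster_closeAt_sealFlip {c m : V} {ω : Config E} (hm : ¬ G.Conn ωᶜ c m) :
    G.cluster (G.closeAt m (G.sealFlip c m ω)) c = G.cluster ωᶜ c := by
  refine cluster_eq_of_agree ?_
  intro e he
  by_cases hem : e ∈ G.edgesAt ({m} : Set V)
  · rw [G.closeAt_apply_of_mem hem]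
    exact compl_eq_false_of_mem_edgesAt_of_mem_edgesAt_m hm he hem
  · rw [G.closeAt_apply_of_notMem hem, sealFlip_apply_of_mem he hem, compl_apply_not]

/-- **mine-3's LEMMA (injectivity)**: the sealed flip `M_m` is injective on `{S : m ∉ Com_c(S̄)}`. -/
theorem sealFlip_injOn (c m : V) : Set.InjOn (G.sealFlip c m) {ω | ¬ G.Conn ωᶜ c m} := by
  intro ω hω ω' hω' h
  have hω₁ : ¬ G.Conn ωᶜ c m := hω
  have hω₂ : ¬ G.Conn ω'ᶜ c m := hω'
  have hD : G.cluster ωᶜ c = G.cluster ω'ᶜ c := by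
    rw [← cluster_closeAt_sealFlip hω₁, ← cluster_closeAt_sealFlip hω₂, h]
  funext e
  have he : G.sealFlip c m ω e = G.sealFlip c m ω' e := congrArg (fun ρ => ρ e) h
  by_cases hem : e ∈ G.edgesAt ({m} : Set V)
  · rwa [sealFlip_apply_of_mem_m hem, sealFlip_apply_of_mem_m hem] at he
  · by_cases hD1 : e ∈ G.edgesAt (G.cluster ωᶜ c)
    · have hD2 : e ∈ G.edgesAt (G.cluster ω'ᶜ c) := by rwa [← hD]
      rw [sealFlip_apply_of_mem hD1 hem, sealFlip_apply_of_mem hD2 hem] at he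
      exact Bool.not_inj he
    · have hD2 : e ∉ G.edgesAt (G.cluster ω'ᶜ c) := by rwa [← hD]
      rwa [sealFlip_apply_of_notMem hD1, sealFlip_apply_of_notMem hD2] at he

/-- `D` is open-connected in `M_m(S)` (F2: its closed edges are flipped; its boundary edges at `m`,
which are kept, were open). -/
theorem conn_sealFlip_of_conn_compl {c m : V} {ω : Config E} (hm : ¬ G.Conn ωᶜ c m) {v : V}
    (hv : G.Conn ωᶜ c v) : G.Conn (G.sealFlip c m ω) c v := by
  refine conn_of_open_edges ?_ hv
  intro e he hmem
  by_cases hem : e ∈ G.edgesAt ({m} : Set V)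
  · exact absurd he (by
      rw [compl_eq_false_of_mem_edgesAt_of_mem_edgesAt_m hm hmem hem]
      exact Bool.false_ne_true)
  · rw [sealFlip_apply_of_mem hmem hem, ← compl_apply_not]
    exact he

/-- An edge at `m` joining `x` and `y` has `x = m` or `y = m`. -/
theorem eq_or_eq_of_joins_of_mem_edgesAt_singleton {e : E} {x y m : V} (hj : G.Joins e x y)
    (hem : e ∈ G.edgesAt ({m} : Set V)) : x = m ∨ y = m := by
  rcases G.mem_or_mem_of_mem_edgesAt_of_joins hj hem with h | h
  · exact Or.inl (Set.mem_singleton_iff.mp h)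
  · exact Or.inr (Set.mem_singleton_iff.mp h)

/-- When `m` has an open edge into `D`, the mark `m` lies in the open cluster of `c` in `M_m(S)`. -/
theorem conn_sealFlip_m {c m : V} {ω : Config E} (hm : ¬ G.Conn ωᶜ c m)
    (h : G.OpenEdgeInto ω c m) : G.Conn (G.sealFlip c m ω) c m := by
  obtain ⟨e, he, heD, hem⟩ := h
  have hT : G.sealFlip c m ω e = true := by
    rw [sealFlip_apply_of_mem_m hem]
    exact he
  have hadj : G.OpenAdj (G.sealFlip c m ω) (G.fst e) (G.snd e) := G.openAdj_of_open e hT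
  rcases hem with hm' | hm' <;> rw [Set.mem_singleton_iff] at hm'
  · -- `fst e = m`, so `snd e ∈ D`
    have hsnd : G.snd e ∈ G.cluster ωᶜ c := by
      rcases heD with heD | heD
      · exact absurd (by rw [← hm']; exact heD) hm
      · exact heD
    have hc : G.Conn (G.sealFlip c m ω) c (G.fst e) :=
      (conn_sealFlip_of_conn_compl hm hsnd).trans (Conn.of_openAdj hadj.symm)
    rwa [hm'] at hc
  · -- `snd e = m`, so `fst e ∈ D`
    have hfst : G.fst e ∈ G.cluster ωᶜ c := by
      rcases heD with heD | heD
      · exact heD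
      · exact absurd (by rw [← hm']; exact heD) hm
    have hc : G.Conn (G.sealFlip c m ω) c (G.snd e) :=
      (conn_sealFlip_of_conn_compl hm hfst).trans (Conn.of_openAdj hadj)
    rwa [hm'] at hc

/-- Every vertex of the open cluster of `c` in `M_m(S)` lies in `D` or is reached from `m` by an open
path of `S` avoiding `D` (the open exits of `D` in `M_m(S)` lead to `m` only). -/
theorem conn_compl_or_connAvoid_of_conn_sealFlip {c m : V} {ω : Config E}
    (hm : ¬ G.Conn ωᶜ c m) {v : V} (hv : G.Conn (G.sealFlip c m ω) c v) :
    G.Conn ωᶜ c v ∨ G.ConnAvoid ω (G.cluster ωᶜ c) m v := by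
  refine Conn.induction
    (motive := fun x => G.Conn ωᶜ c x ∨ G.ConnAvoid ω (G.cluster ωᶜ c) m x)
    (Or.inl (Conn.refl G ωᶜ c)) ?_ hv
  intro x y _ hxy ih
  obtain ⟨e, he, hend⟩ := hxy
  have hj : G.Joins e x y := hend
  by_cases hyD : G.Conn ωᶜ c y
  · exact Or.inl hyD
  rcases ih with hxD | hxA
  · -- `x ∈ D`, `y ∉ D`: a boundary edge of `D`, open in the image only if it is at `m`; then `y = m`
    have heD : e ∈ G.edgesAt (G.cluster ωᶜ c) := G.mem_edgesAt_of_joins_left hj hxD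
    by_cases hem : e ∈ G.edgesAt ({m} : Set V)
    · rcases eq_or_eq_of_joins_of_mem_edgesAt_singleton hj hem with hxm | hym
      · exact absurd (by rw [← hxm]; exact hxD) hm
      · rw [hym]
        exact Or.inr Relation.ReflTransGen.refl
    · rw [sealFlip_apply_of_mem heD hem, ← compl_apply_not] at he
      exact absurd (G.mem_cluster_of_open_joins he hj hxD) hyD
  · -- `x ∉ D` (the end of an avoiding path), `y ∉ D`: the edge is away from `D`, so it is open in `S`
    have hxD : ¬ G.Conn ωᶜ c x := hxA.notMem_of_notMem hm
    have heD : e ∉ G.edgesAt (G.cluster ωᶜ c) := by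
      intro heD
      rcases G.mem_or_mem_of_mem_edgesAt_of_joins hj heD with h | h
      · exact hxD h
      · exact hyD h
    rw [sealFlip_apply_of_notMem heD] at he
    exact Or.inr (hxA.tail ⟨⟨e, he, hend⟩, hxD, hyD⟩)

/-- An open path of `S` avoiding `D` survives in `M_m(S)` (no edge away from `D` is touched). -/
theorem conn_sealFlip_of_connAvoid {c m : V} {ω : Config E} {u v : V}
    (h : G.ConnAvoid ω (G.cluster ωᶜ c) u v) : G.Conn (G.sealFlip c m ω) u v := by
  unfold ConnAvoid at h
  induction h with
  | refl => exact Conn.refl G _ u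
  | tail _ hxy ih =>
    obtain ⟨⟨e, he, hend⟩, hx, hy⟩ := hxy
    have hj : G.Joins e _ _ := hend
    have heD : e ∉ G.edgesAt (G.cluster ωᶜ c) := by
      intro heD
      rcases G.mem_or_mem_of_mem_edgesAt_of_joins hj heD with h | h
      · exact hx h
      · exact hy h
    refine ih.tail ⟨e, ?_, hend⟩
    rw [sealFlip_apply_of_notMem heD]
    exact he

/-- **mine-3's LEMMA (the cluster)**: when `m ∉ D` has an open edge into `D`, the open cluster of `c` in
`M_m(S)` is `D ∪ A_m`, `A_m` = the vertices reached from `m` by open paths of `S` avoiding `D`. -/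
theorem cluster_sealFlip_eq {c m : V} {ω : Config E} (hm : ¬ G.Conn ωᶜ c m)
    (hop : G.OpenEdgeInto ω c m) :
    G.cluster (G.sealFlip c m ω) c =
      G.cluster ωᶜ c ∪ {v | G.ConnAvoid ω (G.cluster ωᶜ c) m v} := by
  ext v
  simp only [mem_cluster, Set.mem_union, Set.mem_setOf_eq]
  constructor
  · exact conn_compl_or_connAvoid_of_conn_sealFlip hm
  · rintro (h | h)
    · exact conn_sealFlip_of_conn_compl hm h
    · exact (conn_sealFlip_m hm hop).trans (conn_sealFlip_of_connAvoid h)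

/-! ### THEOREM M -/

/-- The sealed flip of a direct-access source for `m` against `m'` lies in the cell `mc|m'`. -/
theorem conn_and_not_conn_sealFlip_of_directSource {c m m' : V} {ω : Config E}
    (h : G.DirectSource ω c m m') :
    G.Conn (G.sealFlip c m ω) c m ∧ ¬ G.Conn (G.sealFlip c m ω) c m' := by
  obtain ⟨hm, hm', hav, hop⟩ := h
  refine ⟨conn_sealFlip_m hm hop, fun hc => ?_⟩
  rcases conn_compl_or_connAvoid_of_conn_sealFlip hm hc with h1 | h1
  · exact hm' h1
  · exact hav h1

open Classical in
/-- **THEOREM M, general form**: the direct-access sources for `m` against `m'` are at most as many as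
the configurations of the cell `mc|m'` (`M_m` is an injection into it). -/
theorem card_directSource_le [Fintype E] (c m m' : V) :
    (univ.filter fun ω : Config E => G.DirectSource ω c m m').card ≤
      (univ.filter fun ω : Config E => G.Conn ω c m ∧ ¬ G.Conn ω c m').card := by
  refine Finset.card_le_card_of_injOn (G.sealFlip c m) ?_ ?_
  · intro ω hω
    simp only [Finset.coe_filter, Finset.mem_univ, true_and, Set.mem_setOf_eq] at hω ⊢
    exact conn_and_not_conn_sealFlip_of_directSource hω
  · intro ω hω ω' hω' h
    simp only [Finset.coe_filter, Finset.mem_univ, true_and, Set.mem_setOf_eq] at hω hω'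
    exact sealFlip_injOn c m hω.1 hω'.1 h

open Classical in
/-- **THEOREM M (the `a`-side)**: `#N²_a ≤ #ac|b` — the configurations of `N²` in which `a` has an open
edge into the closed `c`-cluster are at most as many as those of the cell `ac|b`. -/
theorem card_nTwo_a_le [Fintype E] (a b c : V) :
    (univ.filter fun ω : Config E => G.NTwo ω a b c ∧ G.OpenEdgeInto ω c a).card ≤
      (univ.filter fun ω : Config E => G.Conn ω c a ∧ ¬ G.Conn ω c b).card := by
  refine le_trans (Finset.card_le_card ?_) (card_directSource_le c a b)
  intro ω hω
  simp only [Finset.mem_filter, Finset.mem_univ, true_and] at hω ⊢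
  exact ⟨hω.1.2.1, hω.1.2.2.1, hω.1.2.2.2, hω.2⟩

open Classical in
/-- **THEOREM M (the `b`-side)**: `#N²_b ≤ #bc|a`. -/
theorem card_nTwo_b_le [Fintype E] (a b c : V) :
    (univ.filter fun ω : Config E => G.NTwo ω a b c ∧ G.OpenEdgeInto ω c b).card ≤
      (univ.filter fun ω : Config E => G.Conn ω c b ∧ ¬ G.Conn ω c a).card := by
  refine le_trans (Finset.card_le_card ?_) (card_directSource_le c b a)
  intro ω hω
  simp only [Finset.mem_filter, Finset.mem_univ, true_and] at hω ⊢
  exact ⟨hω.1.2.2.1, hω.1.2.1, fun h => hω.1.2.2.2 h.symm, hω.2⟩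

open Classical in
/-- **THEOREM M (the sum)**: `#N²_a + #N²_b ≤ #ac|b + #bc|a`, i.e.
`2#(N²_a ∩ N²_b) + #(N²_a ∖ N²_b) + #(N²_b ∖ N²_a) ≤ #ac|b + #bc|a`. -/
theorem card_nTwo_a_add_nTwo_b_le [Fintype E] (a b c : V) :
    (univ.filter fun ω : Config E => G.NTwo ω a b c ∧ G.OpenEdgeInto ω c a).card +
        (univ.filter fun ω : Config E => G.NTwo ω a b c ∧ G.OpenEdgeInto ω c b).card ≤
      (univ.filter fun ω : Config E => G.Conn ω c a ∧ ¬ G.Conn ω c b).card +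
        (univ.filter fun ω : Config E => G.Conn ω c b ∧ ¬ G.Conn ω c a).card :=
  add_le_add (card_nTwo_a_le a b c) (card_nTwo_b_le a b c)

open Classical in
/-- **THEOREM M′ (the deletion side of Lemma T, direct access)**: among the configurations with `a ≁_S b`
whose closed `c`-cluster `D` misses `a` and `b`, those in which `a` has an open edge into `D` are at most
as many as the cell `ac|b` — mine-3's `DB_a` (for an edge `e` of `H` not joining two marks, on
`G = H − e`) is a subset of the left-hand set, so `#DB_a ≤ #ac|b(H − e)`; mirror for `b`. -/
theorem card_sep_openEdgeInto_le [Fintype E] (a b c : V) :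
    (univ.filter fun ω : Config E =>
        ¬ G.Conn ω a b ∧ ¬ G.Conn ωᶜ c a ∧ ¬ G.Conn ωᶜ c b ∧ G.OpenEdgeInto ω c a).card ≤
      (univ.filter fun ω : Config E => G.Conn ω c a ∧ ¬ G.Conn ω c b).card := by
  refine le_trans (Finset.card_le_card ?_) (card_directSource_le c a b)
  intro ω hω
  simp only [Finset.mem_filter, Finset.mem_univ, true_and] at hω ⊢
  exact ⟨hω.2.1, hω.2.2.1, fun h => hω.1 h.conn, hω.2.2.2⟩

end DirectAccess

end MultiGraph

end PercRepro
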